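import Mathlib.RingTheory.MvPowerSeries.Expand
import Mathlib.RingTheory.Derivation.Basic
import Mathlib.FieldTheory.Perfect
import Literature.AlgebraicGeometry.Resolution.PowerSeriesRegularLocal
import Literature.RingTheory.MvPowerSeries.MaximalIdealPow
import Literature.RingTheory.MvPowerSeries.FiniteColength
import Literature.RingTheory.MvPowerSeries.FrobeniusPowerBasis
import HarnessLib

/-!
# Crux `Steer` (stmt-16345), chain W4.1 — the FORMAL TORSOR DICTIONARY, part 1: lemmas

OURS (campaign `res-hironaka`, rung L, slot W4.1, `CRUX-PLAN-Steer.md` §3/§5 items D0/D1d; replaces the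
role of no printed item; NOT a statement of the manuscript under review; AI-produced). Pure lemmas over
Mathlib and `Literature` (no `Theses.*` / `Cruxes.*` import: chain build rule, CHAIN W4.1 v2.1 §imports),
consumed by the definition file `FrobeniusClosingCampaignW41TorsorStates.lean` (the intrinsic state
predicates `MultPAt` / `IsolAt` of a torsor `z ^ p = F` over a local ring) and by the leaf of the C2 cut of
the Steer core (`stub_core4Iso`), which reads the `p`-adic cleaning run of `t ^ p = f` along a
zero-dimensional valuation as a run of the typed point-blow-up dynamics of routes `FrobeniusClosing` /
`WildCones` (`Theorems/WildConesClassicalRegimesDefs.lean`: `clean`, `ser`, `jac`, `Isol`, `MultP`) in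
order to consume the THEOREM `IsolatedForcedTermination_proof`. What is proved, for `B = κ⟦u_σ⟧`:

* §1 Derivations. `Derivation.apply_mem_pow_of_mem_pow_succ` (`δ(I^{N+1}) ⊆ I^N`),
  `Derivation.apply_pow_char_eq_zero` / `apply_add_pow_char` (`δ(g^p) = 0` in characteristic `p`),
  `derivation_C_eq_zero` (every `ℤ`-derivation of `B` kills a PERFECT coefficient field),
  `derivation_apply_eq_sum_pderiv` (**`δ F = Σᵢ δ(uᵢ)·∂F/∂uᵢ`** for every `ℤ`-derivation `δ` of `B`),
  whence `span_derivation_apply_eq_span_pderiv`: the INTRINSIC Jacobian ideal `(δ F : δ ∈ Der_ℤ B)`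
  IS the ideal of formal partials `(∂₁F, …, ∂ₙF)` — so the typed `Isol` (finite Milnor algebra of the
  cleaned series) is a statement about the abstract pair `(B, F)`, transportable along any ring
  isomorphism (Cohen structure theorem), and blind to the cleaning (`pderiv_add_pow_char`,
  `pderiv_eq_of_coeff_eq`).
* §2 Multiplicity `p`. `exists_pow_eq_iff` (`F` is a `p`-th power iff all its non-`p`-divisible
  monomials vanish, i.e. its cleaning is `0`); `exists_sub_pow_mem_maximalIdeal_pow_iff`
  (**`∃ g, F − g^p ∈ 𝔪^p` iff every monomial of `F` of degree `< p` with an exponent not divisible by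
  `p` vanishes**, i.e. the cleaned series has order `≥ p` — the typed `MultP`); invariance under
  `F ↦ F + h^p` and `F ↦ w^p F` (`exists_sub_pow_mem_iff_add_pow`, `exists_sub_pow_mem_iff_unit_pow_mul`).
* §3 Finite colength. `finite_quotient_iff_exists_maximalIdeal_pow_le`: `B ⧸ I` finite over `κ` iff
  `𝔪^N ≤ I` for some `N` (assembled from `Literature.RingTheory.MvPowerSeries.Jets`).
* §4 Change of the coefficient field along `φ : κ →+* κ'` (the residue fields grow along the valuation
  run): coefficient conditions, partials and `𝔪`-primary exponents are preserved
  (`forall_coeff_map_eq_zero_iff`, `pderiv_map`, `map_maximalIdeal_eq`,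
  `maximalIdeal_pow_le_span_pderiv_map`).

Sources: standard commutative algebra — H. Matsumura, *Commutative Ring Theory*, CUP 1986, §25–§30
(derivations of power series rings; proof of Thm. 30.9, `k^p⟦x^p⟧ = k⟦x⟧^p` for perfect `k`); the lemmas
are folklore and carry that tag. No definitions in this file.
-/

noncomputable section

-- layout-mandated namespace `Summit.<Summit>.<Problem>.…` with Summit = Problem (single-conjunct summit)
set_option linter.dupNamespace false

open MvPowerSeries IsLocalRing
open Literature.AlgebraicGeometry.Resolution (MvPowerSeries.pderiv MvPowerSeries.coeff_pderiv
  MvPowerSeries.pderiv_X)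
open Literature.RingTheory.MvPowerSeries.Jets
open Literature.RingTheory.MvPowerSeries (IsSupportedOnMultiples isSupportedOnMultiples_pow
  exists_pow_eq_of_isSupportedOnMultiples)

namespace Summit.ResolutionOfSingularities.ResolutionOfSingularities.Theorems.SwitchingDichotomy

namespace TorsorDict

/-! ## §1 Derivations -/

section Derivations

/-- A derivation lowers `I`-adic order by at most one: `δ(I^{N+1}) ⊆ I^N`. [folklore] -/
theorem _root_.Derivation.apply_mem_pow_of_mem_pow_succ {A : Type*} [CommRing A] {R₀ : Type*}
    [CommSemiring R₀] [Algebra R₀ A] (δ : Derivation R₀ A A) (I : Ideal A) :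
    ∀ (N : ℕ) {x : A}, x ∈ I ^ (N + 1) → δ x ∈ I ^ N := by
  intro N
  induction N with
  | zero => intro x _; simp
  | succ N ih =>
    intro x hx
    rw [pow_succ] at hx
    refine Submodule.mul_induction_on hx (fun y hy z hz => ?_) (fun x y hx hy => ?_)
    · rw [Derivation.leibniz, smul_eq_mul, smul_eq_mul]
      refine Ideal.add_mem _ (Ideal.mul_mem_right (δ z) _ hy) ?_
      rw [pow_succ']
      exact Ideal.mul_mem_mul hz (ih hy)
    · rw [map_add]; exact Ideal.add_mem _ hx hy

/-- In characteristic `p` every derivation kills `p`-th powers: `δ(g^p) = p·g^{p-1}·δ g = 0`.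
[folklore] -/
theorem _root_.Derivation.apply_pow_char_eq_zero {A : Type*} [CommRing A] {R₀ : Type*}
    [CommSemiring R₀] [Algebra R₀ A] (δ : Derivation R₀ A A) (p : ℕ) [CharP A p] (g : A) :
    δ (g ^ p) = 0 := by
  rw [Derivation.leibniz_pow, ← Nat.cast_smul_eq_nsmul A, CharP.cast_eq_zero, zero_smul]

/-- Hence derivations do not see `p`-th-power corrections: `δ (F + h^p) = δ F`. [folklore] -/
theorem _root_.Derivation.apply_add_pow_char {A : Type*} [CommRing A] {R₀ : Type*}
    [CommSemiring R₀] [Algebra R₀ A] (δ : Derivation R₀ A A) (p : ℕ) [CharP A p] (F h : A) :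
    δ (F + h ^ p) = δ F := by
  rw [map_add, δ.apply_pow_char_eq_zero p h, add_zero]

variable {σ : Type*} {κ : Type*} [Field κ]

/-- `κ⟦u⟧` has characteristic `p` when `κ` has (a `Prop`; use with `haveI`). [folklore] -/
theorem charP_mvPowerSeries (p : ℕ) [CharP κ p] : CharP (MvPowerSeries σ κ) p :=
  charP_of_injective_algebraMap (C_injective (σ := σ) (R := κ)) p

/-- Every `ℤ`-derivation of `κ⟦u⟧` kills the constants when `κ` is PERFECT of characteristic `p`
(`a = b^p`, so `δ(a) = p b^{p-1} δ(b) = 0`): the coefficient field is canonical. [folklore] -/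
theorem derivation_C_eq_zero (p : ℕ) [Fact p.Prime] [CharP κ p] [PerfectField κ]
    (δ : Derivation ℤ (MvPowerSeries σ κ) (MvPowerSeries σ κ)) (a : κ) :
    δ (C a) = 0 := by
  haveI : ExpChar κ p := ExpChar.prime Fact.out
  haveI := charP_mvPowerSeries (σ := σ) (κ := κ) p
  obtain ⟨b, rfl⟩ := surjective_frobenius κ p a
  rw [frobenius_def, map_pow]
  exact δ.apply_pow_char_eq_zero p _


/-- `∂/∂uᵢ` kills the constants. [folklore] -/
theorem pderiv_C (i : σ) (a : κ) : MvPowerSeries.pderiv i (C a : MvPowerSeries σ κ) = 0 := by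
  rw [MvPowerSeries.c_eq_algebraMap]
  exact (MvPowerSeries.pderiv i).map_algebraMap a

/-- **Derivations of `κ⟦u⟧` over a perfect field: `δ F = Σᵢ δ(uᵢ) · ∂F/∂uᵢ`** for every
`ℤ`-derivation `δ` (so `Der(κ⟦u⟧)` is free on `∂/∂u₁, …, ∂/∂uₙ`: a derivation kills the perfect
coefficient field and is `𝔪`-adically continuous, and polynomials are dense). Proof: the defect
`E(G) = δ G − Σᵢ δ(uᵢ)·∂ᵢG` is additive, satisfies Leibniz, kills constants and variables — hence all
polynomials — and maps `𝔪^{N+1}` into `𝔪^N`; so `E(F) ∈ ⋂_N 𝔪^N = 0`. [folklore] -/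
theorem derivation_apply_eq_sum_pderiv [Fintype σ] (p : ℕ) [Fact p.Prime] [CharP κ p] [PerfectField κ]
    (δ : Derivation ℤ (MvPowerSeries σ κ) (MvPowerSeries σ κ)) (F : MvPowerSeries σ κ) :
    δ F = ∑ i, δ (X i) * MvPowerSeries.pderiv i F := by
  classical
  -- the defect `E`
  set E : MvPowerSeries σ κ → MvPowerSeries σ κ :=
    fun G => δ G - ∑ i, δ (X i) * MvPowerSeries.pderiv i G with hE
  have hE_add : ∀ G H, E (G + H) = E G + E H := fun G H => by
    simp only [hE, map_add, mul_add, Finset.sum_add_distrib]; ring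
  have hE_mul : ∀ G H, E (G * H) = G * E H + H * E G := fun G H => by
    simp only [hE, Derivation.leibniz, smul_eq_mul, mul_add, mul_sub, Finset.mul_sum,
      Finset.sum_add_distrib]; ring
  have hE_X : ∀ j, E (X j) = 0 := fun j => by
    simp only [hE, MvPowerSeries.pderiv_X, mul_ite, mul_one, mul_zero, Finset.sum_ite_eq,
      Finset.mem_univ, if_true, sub_self]
  have hE_C : ∀ a, E (C a) = 0 := fun a => by
    simp only [hE, derivation_C_eq_zero p δ a, pderiv_C, mul_zero, Finset.sum_const_zero, sub_self]
  -- `E` vanishes on polynomials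
  have hE_coe : ∀ P : MvPolynomial σ κ, E (P : MvPowerSeries σ κ) = 0 := fun P => by
    induction P using MvPolynomial.induction_on with
    | C a => rw [MvPolynomial.coe_C]; exact hE_C a
    | add P Q hP hQ => rw [MvPolynomial.coe_add, hE_add, hP, hQ, add_zero]
    | mul_X P j hP => rw [MvPolynomial.coe_mul, MvPolynomial.coe_X, hE_mul, hE_X, hP, mul_zero,
        mul_zero, add_zero]
  -- `E` is `𝔪`-adically continuous
  have hE_pow : ∀ (N : ℕ) {G : MvPowerSeries σ κ}, G ∈ maximalIdeal (MvPowerSeries σ κ) ^ (N + 1) →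
      E G ∈ maximalIdeal (MvPowerSeries σ κ) ^ N := fun N G hG => by
    refine Ideal.sub_mem _ (δ.apply_mem_pow_of_mem_pow_succ _ N hG) (Ideal.sum_mem _ fun i _ => ?_)
    exact Ideal.mul_mem_left _ _ ((MvPowerSeries.pderiv i).apply_mem_pow_of_mem_pow_succ _ N hG)
  -- conclusion: every coefficient of `E F` vanishes
  rw [← sub_eq_zero]
  change E F = 0
  ext e
  rw [map_zero]
  have hsplit : F = ↑(truncTotal (e.degree + 2) F) + (F - ↑(truncTotal (e.degree + 2) F)) := by ring
  have hmem : E F ∈ maximalIdeal (MvPowerSeries σ κ) ^ (e.degree + 1) := by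
    rw [hsplit, hE_add, hE_coe, zero_add]
    exact hE_pow _ (sub_coe_truncTotal_mem_maximalIdeal_pow _ F)
  exact coeff_eq_zero_of_mem_maximalIdeal_pow hmem (Nat.lt_succ_self _)

/-- **The intrinsic Jacobian ideal of `F ∈ κ⟦u⟧` is the ideal of formal partials**:
`(δ F : δ ∈ Der_ℤ κ⟦u⟧) = (∂₁F, …, ∂ₙF)` (`κ` perfect of characteristic `p`). [folklore] -/
theorem span_derivation_apply_eq_span_pderiv [Fintype σ] (p : ℕ) [Fact p.Prime] [CharP κ p]
    [PerfectField κ] (F : MvPowerSeries σ κ) :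
    Ideal.span (Set.range fun δ : Derivation ℤ (MvPowerSeries σ κ) (MvPowerSeries σ κ) => δ F) =
      Ideal.span (Set.range fun i : σ => MvPowerSeries.pderiv i F) := by
  apply le_antisymm
  · rw [Ideal.span_le]
    rintro _ ⟨δ, rfl⟩
    show δ F ∈ Ideal.span (Set.range fun i : σ => MvPowerSeries.pderiv i F)
    rw [derivation_apply_eq_sum_pderiv p δ F]
    exact Ideal.sum_mem _ fun i _ => Ideal.mul_mem_left _ _ (Ideal.subset_span ⟨i, rfl⟩)
  · rw [Ideal.span_le]
    rintro _ ⟨i, rfl⟩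
    exact Ideal.subset_span ⟨(MvPowerSeries.pderiv i).restrictScalars ℤ, rfl⟩

/-- Formal partials do not see `p`-th-power corrections (characteristic `p`). [folklore] -/
theorem pderiv_add_pow_char (p : ℕ) [CharP κ p] (i : σ) (F h : MvPowerSeries σ κ) :
    MvPowerSeries.pderiv i (F + h ^ p) = MvPowerSeries.pderiv i F := by
  haveI := charP_mvPowerSeries (σ := σ) (κ := κ) p
  exact (MvPowerSeries.pderiv i).apply_add_pow_char p F h

/-- Two series with the same NON-`p`-divisible monomials have the same formal partials
(characteristic `p`): in particular a series and its `p`-CLEANING (deletion of the monomials `u^A`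
with `p ∣ A`) have the same Jacobian ideal. [folklore] -/
theorem pderiv_eq_of_coeff_eq (p : ℕ) [CharP κ p] (i : σ) {F G : MvPowerSeries σ κ}
    (h : ∀ e : σ →₀ ℕ, (∃ j, ¬ p ∣ e j) → coeff e F = coeff e G) :
    MvPowerSeries.pderiv i F = MvPowerSeries.pderiv i G := by
  ext e
  rw [MvPowerSeries.coeff_pderiv, MvPowerSeries.coeff_pderiv]
  by_cases hall : ∀ j, p ∣ (e + Finsupp.single i 1 : σ →₀ ℕ) j
  · have hi : p ∣ e i + 1 := by simpa using hall i
    have h0 : ((e i : κ) + 1) = 0 := by exact_mod_cast (CharP.cast_eq_zero_iff κ p (e i + 1)).mpr hi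
    rw [h0, zero_mul, zero_mul]
  · push Not at hall
    rw [h _ hall]

end Derivations


/-! ## §2 Multiplicity `p`: `p`-th-power corrections and the cleaned order -/

section MultP

variable {σ : Type*} {κ : Type*} [Field κ] (p : ℕ) [Fact p.Prime] [CharP κ p]

/-- `p`-th powers of `κ⟦u⟧` live on the `p`-divisible monomials. [folklore] -/
theorem coeff_pow_char_eq_zero (g : MvPowerSeries σ κ) {e : σ →₀ ℕ} (he : ∃ j, ¬ p ∣ e j) :
    coeff e (g ^ p) = 0 := by
  haveI : ExpChar κ p := ExpChar.prime Fact.out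
  have h := isSupportedOnMultiples_pow p g 1
  rw [pow_one] at h
  exact h e he

/-- **A series over a PERFECT field is a `p`-th power iff all its non-`p`-divisible monomials
vanish** (i.e. iff its `p`-cleaning is `0`). [folklore] -/
theorem exists_pow_eq_iff [PerfectField κ] (F : MvPowerSeries σ κ) :
    (∃ g : MvPowerSeries σ κ, g ^ p = F) ↔ ∀ e : σ →₀ ℕ, (∃ j, ¬ p ∣ e j) → coeff e F = 0 := by
  haveI : ExpChar κ p := ExpChar.prime Fact.out
  have h := Literature.RingTheory.MvPowerSeries.isSupportedOnMultiples_iff_exists_pow_eq p F 1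
  rw [pow_one] at h
  exact h.symm

/-- `p`-th-power corrections do not change the property "`F ≡` a `p`-th power `(mod I)`"
(characteristic `p`, any ideal `I`, any commutative ring). [folklore] -/
theorem exists_sub_pow_mem_iff_add_pow {A : Type*} [CommRing A] [CharP A p] (I : Ideal A)
    (F h : A) : (∃ g : A, F + h ^ p - g ^ p ∈ I) ↔ ∃ g : A, F - g ^ p ∈ I := by
  constructor
  · rintro ⟨g, hg⟩
    refine ⟨g - h, ?_⟩
    rw [sub_pow_char g h]
    convert hg using 1
    ring
  · rintro ⟨g, hg⟩
    refine ⟨g + h, ?_⟩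
    rw [add_pow_char g h]
    convert hg using 1
    ring

omit [Fact p.Prime] [CharP κ p] in
/-- Scaling by a `p`-th-power UNIT does not change it either (`t ↦ w·t` on the torsor
`t ^ p = F`). [folklore] -/
theorem exists_sub_pow_mem_iff_unit_pow_mul {A : Type*} [CommRing A] (I : Ideal A) (F : A)
    {w : A} (hw : IsUnit w) : (∃ g : A, w ^ p * F - g ^ p ∈ I) ↔ ∃ g : A, F - g ^ p ∈ I := by
  obtain ⟨w, rfl⟩ := hw
  constructor
  · rintro ⟨g, hg⟩
    refine ⟨↑w⁻¹ * g, ?_⟩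
    have : F - (↑w⁻¹ * g) ^ p = (↑w⁻¹ : A) ^ p * ((w : A) ^ p * F - g ^ p) := by
      rw [mul_pow, mul_sub, ← mul_assoc, ← mul_pow (↑w⁻¹ : A) (↑w : A), Units.inv_mul, one_pow,
        one_mul]
    rw [this]
    exact Ideal.mul_mem_left _ _ hg
  · rintro ⟨g, hg⟩
    refine ⟨↑w * g, ?_⟩
    rw [mul_pow, ← mul_sub]
    exact Ideal.mul_mem_left _ _ hg

/-- If `F ≡ g^p (mod 𝔪^p)` then every monomial of `F` of degree `< p` with some exponent not
divisible by `p` vanishes (the cleaned series has order `≥ p`). [folklore] -/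
theorem coeff_eq_zero_of_sub_pow_mem {F g : MvPowerSeries σ κ}
    (h : F - g ^ p ∈ maximalIdeal (MvPowerSeries σ κ) ^ p) {e : σ →₀ ℕ} (he : ∃ j, ¬ p ∣ e j)
    (hd : e.degree < p) : coeff e F = 0 := by
  have h1 : coeff e (F - g ^ p) = 0 := coeff_eq_zero_of_mem_maximalIdeal_pow h hd
  rwa [map_sub, coeff_pow_char_eq_zero p g he, sub_zero] at h1

variable [Finite σ]

/-- **Multiplicity `p` in the formal dictionary.** Over a PERFECT field `κ` of characteristic `p`,
`F ∈ κ⟦u⟧` is congruent to a `p`-th power modulo `𝔪^p` iff every monomial of `F` of degree `< p`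
with some exponent not divisible by `p` vanishes — i.e. iff the `p`-CLEANED series of `F` has order
`≥ p` (the typed `MultP`, second conjunct). [folklore] -/
theorem exists_sub_pow_mem_maximalIdeal_pow_iff [PerfectField κ] (F : MvPowerSeries σ κ) :
    (∃ g : MvPowerSeries σ κ, F - g ^ p ∈ maximalIdeal (MvPowerSeries σ κ) ^ p) ↔
      ∀ e : σ →₀ ℕ, (∃ j, ¬ p ∣ e j) → e.degree < p → coeff e F = 0 := by
  classical
  haveI : ExpChar κ p := ExpChar.prime Fact.out
  constructor
  · rintro ⟨g, hg⟩ e he hd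
    exact coeff_eq_zero_of_sub_pow_mem p hg he hd
  · intro h
    -- the `p`-divisible part `P` of `F` is a `p`-th power
    let P : MvPowerSeries σ κ := fun m => if ∀ i, p ∣ m i then coeff m F else 0
    have hcoeffP : ∀ m : σ →₀ ℕ, coeff m P = if ∀ i, p ∣ m i then coeff m F else 0 := fun m => rfl
    have hP : IsSupportedOnMultiples (p ^ 1) P := by
      rintro m ⟨i, hi⟩
      rw [pow_one] at hi
      rw [hcoeffP, if_neg fun hall => hi (hall i)]
    obtain ⟨g, hg⟩ := exists_pow_eq_of_isSupportedOnMultiples p hP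
    rw [pow_one] at hg
    refine ⟨g, mem_maximalIdeal_pow_of_coeff_eq_zero fun e hd => ?_⟩
    rw [map_sub, hg, hcoeffP]
    by_cases hall : ∀ i, p ∣ e i
    · rw [if_pos hall, sub_self]
    · push Not at hall
      rw [if_neg (not_forall.mpr (hall.imp fun _ h => h)), sub_zero]
      exact h e hall hd

end MultP

/-! ## §3 Finite colength -/

section Colength

variable {σ : Type*} [Finite σ] {κ : Type*} [Field κ]

/-- **Finite Milnor algebra ⟺ `𝔪`-primary Jacobian ideal, formally**: for an ideal `I` of `κ⟦u⟧`,
`κ⟦u⟧ ⧸ I` is finite-dimensional over `κ` iff `𝔪^N ≤ I` for some `N`. [folklore] -/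
theorem finite_quotient_iff_exists_maximalIdeal_pow_le (I : Ideal (MvPowerSeries σ κ)) :
    Module.Finite κ (MvPowerSeries σ κ ⧸ I) ↔ ∃ N : ℕ, maximalIdeal (MvPowerSeries σ κ) ^ N ≤ I := by
  constructor
  · intro h
    exact exists_maximalIdeal_pow_le_of_finite_quotient I
  · rintro ⟨N, hN⟩
    haveI := finite_quotient_maximalIdeal_pow (σ := σ) (K := κ) N
    exact Module.Finite.of_surjective (Ideal.Quotient.factorₐ κ hN).toLinearMap
      (Ideal.Quotient.factor_surjective hN)

end Colength


/-! ## §4 Change of the (perfect) coefficient field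

Along the valuation run the residue fields `k₀ ⊆ k₁ ⊆ ⋯` grow inside `κ = k̄`; the formal states are
read in `κ⟦u⟧` through the coefficient maps `kᵢ⟦u⟧ → κ⟦u⟧`. The three state conditions are
insensitive to this. -/

section BaseChange

variable {σ : Type*} {κ κ' : Type*} [Field κ] [Field κ'] (φ : κ →+* κ')

/-- A coefficient-vanishing condition is invariant under an (injective) change of coefficient
field. [folklore] -/
theorem forall_coeff_map_eq_zero_iff (P : (σ →₀ ℕ) → Prop) (F : MvPowerSeries σ κ) :
    (∀ e, P e → coeff e (map φ F) = 0) ↔ ∀ e, P e → coeff e F = 0 := by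
  simp only [coeff_map, map_eq_zero_iff φ φ.injective]

/-- Formal partials commute with a change of coefficient field. [folklore] -/
theorem pderiv_map (i : σ) (F : MvPowerSeries σ κ) :
    MvPowerSeries.pderiv i (map φ F) = map φ (MvPowerSeries.pderiv i F) := by
  ext e
  simp only [MvPowerSeries.coeff_pderiv, coeff_map, map_mul, map_add, map_natCast, map_one]

variable [Finite σ]

/-- The extension of `𝔪_{κ⟦u⟧}` to `κ'⟦u⟧` is `𝔪_{κ'⟦u⟧}`. [folklore] -/
theorem map_maximalIdeal_eq :
    Ideal.map (map (σ := σ) φ) (maximalIdeal (MvPowerSeries σ κ)) = maximalIdeal (MvPowerSeries σ κ') := by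
  rw [Literature.AlgebraicGeometry.Resolution.maximalIdeal_mvPowerSeries_eq_span,
    Literature.AlgebraicGeometry.Resolution.maximalIdeal_mvPowerSeries_eq_span, Ideal.map_span]
  congr 1
  ext G
  constructor
  · rintro ⟨_, ⟨i, rfl⟩, rfl⟩; exact ⟨i, (map_X φ i).symm⟩
  · rintro ⟨i, rfl⟩; exact ⟨X i, ⟨i, rfl⟩, map_X φ i⟩

/-- **An `𝔪`-primary ideal stays `𝔪`-primary (same exponent) after a change of coefficient field**:
if `𝔪^N ≤ (S)` in `κ⟦u⟧` then `𝔪^N ≤ (φ S)` in `κ'⟦u⟧`. [folklore] -/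
theorem maximalIdeal_pow_le_span_image_of_le {N : ℕ} {S : Set (MvPowerSeries σ κ)}
    (h : maximalIdeal (MvPowerSeries σ κ) ^ N ≤ Ideal.span S) :
    maximalIdeal (MvPowerSeries σ κ') ^ N ≤ Ideal.span (map φ '' S) := by
  rw [← map_maximalIdeal_eq φ, ← Ideal.map_pow, ← Ideal.map_span]
  exact Ideal.map_mono h

/-- In particular for Jacobian ideals: `𝔪^N ≤ (∂F)` in `κ⟦u⟧` gives `𝔪^N ≤ (∂(φF))` in `κ'⟦u⟧`.
[folklore] -/
theorem maximalIdeal_pow_le_span_pderiv_map {N : ℕ} {F : MvPowerSeries σ κ}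
    (h : maximalIdeal (MvPowerSeries σ κ) ^ N ≤ Ideal.span (Set.range fun i => MvPowerSeries.pderiv i F)) :
    maximalIdeal (MvPowerSeries σ κ') ^ N ≤
      Ideal.span (Set.range fun i => MvPowerSeries.pderiv i (map φ F)) := by
  have := maximalIdeal_pow_le_span_image_of_le φ h
  rwa [← Set.range_comp, show (⇑(map (σ := σ) φ) ∘ fun i => MvPowerSeries.pderiv i F) =
    fun i => MvPowerSeries.pderiv i (map φ F) from funext fun i => (pderiv_map φ i F).symm] at this

end BaseChange

end TorsorDict

end Summit.ResolutionOfSingularities.ResolutionOfSingularities.Theorems.SwitchingDichotomy
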